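import Mathlib
import HarnessLib
import Summits.Parity.GeneralizedHardyLittlewood.Theorems.DilatedChowla.Negative.DilatedChowlaMirrorBias

/-!
# `DilatedChowla` (stmt-Parity-13319): Siegel zeros of quality `≥ C₀ log q` force a coherent bias

Line `Sketch` (card `siegel-mirror`), stub E, second half: the parameter bookkeeping.  From the
unit-class law `OnePointExc` (constants `c₁, C₁, C₂`) and Siegel zeros `L(1 − 1/(η log q), χ) = 0`
of quality `η ≥ C₀ log q`, `C₀ = 9C₁ + 4/c₁ + 4`, at arbitrarily large conductors `q`, we build the
witnesses of `CoherentBias 1`: `V = q`, `σ = 1`, `M = ⌈exp(C₁(1 + 2 log q)²)⌉`,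
`b = 1/(4C₂(1 + 2 log q)⁵)`, using the per-level lower bound `bias_P_lower` of the first half
(`DilatedChowlaMirrorBias`) along each dilation `k = qν`, `1 ≤ ν ≤ q`.

* `bias_R1_eventually`, `bias_eventually` : the size requirements on `q` (polylog versus power:
  `64 C₂² (1 + 2 log q)^{10} ≤ q`, `q·C ≤ exp(C₁(1 + 2 log q)²)^κ`, `q² ≤ 2 exp(C₁(1 + 2 log q)²)`,
  `q ≥ 12`) hold for all large `q` (`Real.isLittleO_pow_log_id_atTop`).
* `coherentBias_one_of_onePointExc` : the stub.

Elementary; no cited facts (the law `OnePointExc` is a hypothesis).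
-/

noncomputable section

namespace Summit.Parity.GeneralizedHardyLittlewood.Theorems.DilatedChowla.Negative

open Literature.Barriers.Parity (IsSiegelZero)
open Finset

/-! ## §1 The size requirements on the conductor hold eventually -/

/-- Polylog versus linear: `64 C₂² (1 + 2 log x)^{10} ≤ x` for all large real `x`. -/
theorem bias_R1_eventually (C₂ : ℝ) :
    ∀ᶠ x : ℝ in Filter.atTop, 64 * C₂ ^ 2 * (1 + 2 * Real.log x) ^ 10 ≤ x := by
  have hc : (0 : ℝ) < 1 / (64 * C₂ ^ 2 * 3 ^ 10 + 1) := by positivity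
  filter_upwards [(Real.isLittleO_pow_log_id_atTop (n := 10)).bound hc,
    Real.tendsto_log_atTop.eventually_ge_atTop 1, Filter.eventually_ge_atTop (0 : ℝ)]
    with x hx hlog hx0
  rw [Real.norm_eq_abs, Real.norm_eq_abs, id_eq, abs_of_nonneg hx0] at hx
  have h10 : Real.log x ^ 10 ≤ 1 / (64 * C₂ ^ 2 * 3 ^ 10 + 1) * x := le_trans (le_abs_self _) hx
  have h1 : (1 + 2 * Real.log x) ^ 10 ≤ (3 * Real.log x) ^ 10 :=
    pow_le_pow_left₀ (by linarith) (by linarith) 10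
  have hl0 : 0 ≤ Real.log x ^ 10 := pow_nonneg (by linarith) 10
  calc 64 * C₂ ^ 2 * (1 + 2 * Real.log x) ^ 10 ≤ 64 * C₂ ^ 2 * (3 * Real.log x) ^ 10 :=
        mul_le_mul_of_nonneg_left h1 (by positivity)
    _ = (64 * C₂ ^ 2 * 3 ^ 10) * Real.log x ^ 10 := by ring
    _ ≤ (64 * C₂ ^ 2 * 3 ^ 10 + 1) * Real.log x ^ 10 := by nlinarith
    _ ≤ (64 * C₂ ^ 2 * 3 ^ 10 + 1) * (1 / (64 * C₂ ^ 2 * 3 ^ 10 + 1) * x) :=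
        mul_le_mul_of_nonneg_left h10 (by positivity)
    _ = x := by field_simp

/-- The size requirements on the conductor `q` used by the main theorem hold for all large `q`:
(R1) `64 C₂² (1 + 2 log q)^{10} ≤ q`, (R2) `q · C ≤ exp(C₁ (1 + 2 log q)²)^κ`,
(R3) `q² ≤ 2 exp(C₁ (1 + 2 log q)²)`, and `q ≥ 12`. -/
theorem bias_eventually {C₁ κ : ℝ} (hC₁ : 0 < C₁) (hκ : 0 < κ) (C₂ C : ℝ) :
    ∃ q₁ : ℕ, ∀ q : ℕ, q₁ ≤ q →
      64 * C₂ ^ 2 * (1 + 2 * Real.log q) ^ 10 ≤ q ∧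
      (q : ℝ) * C ≤ Real.exp (C₁ * (1 + 2 * Real.log q) ^ 2) ^ κ ∧
      (q : ℝ) ^ 2 ≤ 2 * Real.exp (C₁ * (1 + 2 * Real.log q) ^ 2) ∧ 12 ≤ q := by
  have hlog : Filter.Tendsto (fun q : ℕ => Real.log (q : ℝ)) Filter.atTop Filter.atTop :=
    Real.tendsto_log_atTop.comp tendsto_natCast_atTop_atTop
  set C' := max C 1 with hC'
  have hC'0 : 0 < C' := lt_of_lt_of_le one_pos (le_max_right _ _)
  have hlC' : 0 ≤ Real.log C' := Real.log_nonneg (le_max_right _ _)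
  have e1 := tendsto_natCast_atTop_atTop.eventually (bias_R1_eventually C₂)
  have e2 := hlog.eventually_ge_atTop
    (max 1 (max ((1 + Real.log C') / (4 * κ * C₁)) (1 / (2 * C₁))))
  have e3 := Filter.eventually_ge_atTop (12 : ℕ)
  obtain ⟨q₁, hq₁⟩ := Filter.eventually_atTop.1 (e1.and (e2.and e3))
  refine ⟨q₁, fun q hq => ?_⟩
  obtain ⟨h1, h2, h3⟩ := hq₁ q hq
  simp only [max_le_iff] at h2
  obtain ⟨hL1, hL2, hL3⟩ := h2
  have hq12 : (12 : ℝ) ≤ q := by exact_mod_cast h3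
  have hq0 : (0 : ℝ) < q := by linarith
  have hqexp : (q : ℝ) = Real.exp (Real.log q) := (Real.exp_log hq0).symm
  have hsq : 4 * Real.log q ^ 2 ≤ (1 + 2 * Real.log q) ^ 2 := by nlinarith
  refine ⟨h1, ?_, ?_, h3⟩
  · -- (R2)
    have hκC : 0 < 4 * κ * C₁ := by positivity
    have hA : 1 + Real.log C' ≤ Real.log q * (4 * κ * C₁) := by rwa [div_le_iff₀ hκC] at hL2
    calc (q : ℝ) * C ≤ q * C' := mul_le_mul_of_nonneg_left (le_max_left _ _) hq0.le
      _ = Real.exp (Real.log q + Real.log C') := by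
          rw [Real.exp_add, ← hqexp, Real.exp_log hC'0]
      _ ≤ Real.exp (4 * κ * C₁ * Real.log q ^ 2) := by
          rw [Real.exp_le_exp]
          have : Real.log C' ≤ Real.log C' * Real.log q := le_mul_of_one_le_right hlC' hL1
          nlinarith [mul_le_mul_of_nonneg_right hA (by linarith : 0 ≤ Real.log q)]
      _ ≤ Real.exp (C₁ * (1 + 2 * Real.log q) ^ 2 * κ) := by
          rw [Real.exp_le_exp]
          have := mul_le_mul_of_nonneg_left hsq (by positivity : 0 ≤ κ * C₁)
          nlinarith
      _ = Real.exp (C₁ * (1 + 2 * Real.log q) ^ 2) ^ κ := Real.exp_mul _ _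
  · -- (R3)
    have hC2 : 0 < 2 * C₁ := by positivity
    have hB : 1 ≤ Real.log q * (2 * C₁) := by rwa [div_le_iff₀ hC2] at hL3
    have hq2 : (q : ℝ) ^ 2 = Real.exp (2 * Real.log q) := by
      rw [two_mul, Real.exp_add, ← hqexp, sq]
    calc (q : ℝ) ^ 2 = Real.exp (2 * Real.log q) := hq2
      _ ≤ Real.exp (C₁ * (1 + 2 * Real.log q) ^ 2) := by
          rw [Real.exp_le_exp]
          have := mul_le_mul_of_nonneg_right hB (by linarith : 0 ≤ 2 * Real.log q)
          nlinarith [mul_le_mul_of_nonneg_left hsq hC₁.le]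
      _ ≤ 2 * Real.exp (C₁ * (1 + 2 * Real.log q) ^ 2) := by
          linarith [Real.exp_pos (C₁ * (1 + 2 * Real.log q) ^ 2)]

/-! ## §2 The main theorem: parameter bookkeeping -/

/-- **Stub E (`siegel-mirror`): Siegel zeros of quality `≥ C₀ log q` force a coherent class bias at
shift `1`.**  Given the unit-class law `OnePointExc` (constants `c₁, C₁, C₂`), put
`C₀ = 9C₁ + 4/c₁ + 4`.  If Siegel zeros `L(1 − 1/(η log q), χ) = 0` with `η ≥ C₀ log q` occur at
arbitrarily large conductors `q`, then `CoherentBias 1` holds, with the witnesses (for given `κ, C`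
and a zero at a large conductor `q`): `V = q`, `σ = 1`, `M = ⌈exp(C₁(1 + 2 log q)²)⌉`,
`b = 1/(4C₂(1 + 2 log q)⁵)`; each progression sum `P 1 (qν) M`, `ν ≤ q`, is `≥ bM` by
`bias_P_lower` (the zero is undamped at height `2kM + 1` since `log(2kM+1) ≤ C₀ log² q ≤ η log q`,
and `β > 1 − c₁/log(4k)` since `c₁ η > 4`). -/
theorem coherentBias_one_of_onePointExc (h : OnePointExc) :
    ∃ C₀ : ℝ, 0 < C₀ ∧ (SiegelZerosAbove (fun q => C₀ * Real.log q) → CoherentBias 1) := by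
  obtain ⟨c₁, C₁, C₂, hc₁, hC₁, hC₂, hlaw⟩ := h
  refine ⟨9 * C₁ + 4 / c₁ + 4, by positivity, fun hz κ hκ C => ?_⟩
  obtain ⟨q₁, hq₁⟩ := bias_eventually hC₁ hκ C₂ C
  obtain ⟨q, hqne, χ, η, hq₁q, hηq, hsz⟩ := hz q₁
  obtain ⟨hR1, hR2, hR3, hq12⟩ := hq₁ q hq₁q
  have hηq : (9 * C₁ + 4 / c₁ + 4) * Real.log q ≤ η := hηq
  -- sizes
  have hq3 : (3 : ℝ) ≤ q := by exact_mod_cast hsz.three_le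
  have hq0 : (0 : ℝ) < q := by linarith
  have hq12R : (12 : ℝ) ≤ q := by exact_mod_cast hq12
  have hL1 : 1 < Real.log q := by
    rw [Real.lt_log_iff_exp_lt hq0]
    linarith [Real.exp_one_lt_d9]
  have hL0 : 0 < Real.log q := by linarith
  -- the parameters
  set E := Real.exp (C₁ * (1 + 2 * Real.log q) ^ 2) with hE
  have hE0 : 0 < E := Real.exp_pos _
  have hE1 : 1 ≤ E := Real.one_le_exp (by positivity)
  have hME : E ≤ (⌈E⌉₊ : ℝ) := Nat.le_ceil E
  have hME' : (⌈E⌉₊ : ℝ) < E + 1 := Nat.ceil_lt_add_one hE0.le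
  have hb0 : 0 < 4 * C₂ * (1 + 2 * Real.log q) ^ 5 := by positivity
  refine ⟨⌈E⌉₊, q, q, 1 / (4 * C₂ * (1 + 2 * Real.log q) ^ 5), 1, Or.inl rfl, by omega, by omega,
    ?_, by positivity, ?_, le_trans hR2 (Real.rpow_le_rpow hE0.le hME hκ.le), ?_⟩
  · -- `qV ≤ 2M`
    have : ((q * q : ℕ) : ℝ) ≤ ((2 * ⌈E⌉₊ : ℕ) : ℝ) := by push_cast; nlinarith
    exact_mod_cast this
  · -- `4 ≤ b² V`
    rw [div_pow, one_pow, one_div_mul_eq_div, le_div_iff₀ (by positivity)]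
    have : 4 * (4 * C₂ * (1 + 2 * Real.log q) ^ 5) ^ 2 = 64 * C₂ ^ 2 * (1 + 2 * Real.log q) ^ 10 := by
      ring
    rw [this]
    exact hR1
  · -- the bias along every dilation `qν`, `1 ≤ ν ≤ q`
    intro ν hν hνq
    haveI : NeZero (q * ν) := NeZero.of_pos (Nat.mul_pos (NeZero.pos q) hν)
    rw [one_mul, one_div_mul_eq_div]
    refine bias_P_lower hC₁ hC₂ hlaw (dvd_mul_right q ν) hsz (Nat.le_mul_of_pos_right q hν)
      (Nat.mul_le_mul_left q hνq) hME ?_ ?_ ?_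
    · -- (R4) `4 < c₁ η`
      have h1 : 4 / c₁ * Real.log q ≤ η := by
        have : 4 / c₁ * Real.log q ≤ (9 * C₁ + 4 / c₁ + 4) * Real.log q :=
          mul_le_mul_of_nonneg_right (by linarith [show 0 < 9 * C₁ + 4 by positivity]) hL0.le
        linarith
      have h2 : 4 / c₁ < 4 / c₁ * Real.log q := lt_mul_of_one_lt_right (by positivity) hL1
      have h3 : c₁ * (4 / c₁) = 4 := by field_simp
      calc (4 : ℝ) = c₁ * (4 / c₁) := h3.symm
        _ < c₁ * (4 / c₁ * Real.log q) := mul_lt_mul_of_pos_left h2 hc₁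
        _ ≤ c₁ * η := mul_le_mul_of_nonneg_left h1 hc₁.le
    · -- (R5) undamping: `log (2q²M + 1) ≤ η log q`
      have hy : 2 * (q : ℝ) ^ 2 * (⌈E⌉₊ : ℝ) + 1 ≤ (q : ℝ) ^ 4 * E := by
        have hq9 : (9 : ℝ) ≤ (q : ℝ) ^ 2 := by nlinarith
        have hA : (q : ℝ) ^ 2 ≤ (q : ℝ) ^ 2 * E := le_mul_of_one_le_right (by positivity) hE1
        have hB := mul_le_mul_of_nonneg_left hME'.le (by positivity : (0 : ℝ) ≤ 2 * (q : ℝ) ^ 2)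
        have hC := mul_le_mul_of_nonneg_right hq9 (by positivity : (0 : ℝ) ≤ (q : ℝ) ^ 2 * E)
        nlinarith
      calc Real.log (2 * (q : ℝ) ^ 2 * ⌈E⌉₊ + 1)
          ≤ Real.log ((q : ℝ) ^ 4 * E) := Real.log_le_log (by positivity) hy
        _ = 4 * Real.log q + C₁ * (1 + 2 * Real.log q) ^ 2 := by
            rw [Real.log_mul (by positivity) hE0.ne', Real.log_pow, hE, Real.log_exp]
            push_cast
            ring
        _ ≤ (9 * C₁ + 4) * Real.log q ^ 2 := by
            have h9 : (1 + 2 * Real.log q) ^ 2 ≤ (3 * Real.log q) ^ 2 :=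
              pow_le_pow_left₀ (by linarith) (by linarith) 2
            nlinarith [mul_le_mul_of_nonneg_left h9 hC₁.le]
        _ ≤ (9 * C₁ + 4 / c₁ + 4) * Real.log q * Real.log q := by
            have : 0 ≤ 4 / c₁ * Real.log q ^ 2 := by positivity
            nlinarith
        _ ≤ η * Real.log q := mul_le_mul_of_nonneg_right hηq hL0.le
    · -- (R6) `50 (1 + C₂ (1 + 2 log q)⁵) ≤ q²`, from (R1) and `q ≥ 12`
      have hA0 : 0 ≤ C₂ * (1 + 2 * Real.log q) ^ 5 := by positivity
      have hsq : (8 * (C₂ * (1 + 2 * Real.log q) ^ 5)) ^ 2 ≤ q := by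
        have : (8 * (C₂ * (1 + 2 * Real.log q) ^ 5)) ^ 2 =
            64 * C₂ ^ 2 * (1 + 2 * Real.log q) ^ 10 := by ring
        rw [this]
        exact hR1
      nlinarith [sq_nonneg (8 * (C₂ * (1 + 2 * Real.log q) ^ 5) - 1),
        mul_nonneg (sub_nonneg.2 hq12R) hq0.le]

end Summit.Parity.GeneralizedHardyLittlewood.Theorems.DilatedChowla.Negative

end
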